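import Mathlib
import Literature.NumberTheory.Transcendental.KirbyWeakSchanuelAx
import HarnessLib

/-!
# Route `DiophantineDichotomy`, crux `KhovanskiiApproxTypeEv`, line `anchored-reduction`:
# stub `stub_anchoredBasis` — an integral basis of the dependence space starting with `e₀, e₁`

Crux `Summit.Schanuel.Schanuel.Theses.DiophantineDichotomy.KhovanskiiApproxTypeEv`
(item stmt-Schanuel-14972), line `anchored-reduction` (skeleton of line lead
`prover-line-stmt-Schanuel-14972-0`), registered stub `stub_anchoredBasis` (`--supports`).

In case (b) of the anchored Kirby induction (`stub_anchoredReduction`, Kirby 2010 Prop. 7.1/7.2 run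
inside the class of tuples `x̄ = (1, iπ, x₂, …)`), the dependence space
`V = {q ∈ ℚⁿ⁺² | q·x̄ ∈ ker D}` contains the coordinate vectors `e₀, e₁` (`D 1 = 0`, `D(iπ) = 0`).
This file supplies the pure linear algebra: such a `V` has an INTEGRAL basis `w₀, …, w_{m+1} ∈ ℤⁿ⁺²`
with `w₀ = e₀`, `w₁ = e₁` (so `dim V = m + 2`).

## Proof

`V₂ = {v ∈ V | v₀ = v₁ = 0} ≤ V₁ = {v ∈ V | v₀ = 0} ≤ V`; a basis of `V₂` (`Module.finBasis`) is
extended by `e₁` to a basis of `V₁` and then by `e₀` to a basis `b` of `V`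
(`Module.Basis.mkFinConsOfLE` twice: `z ∈ V₁ ⇒ z − z₁ e₁ ∈ V₂`, and `c e₁ + x = 0`, `x ∈ V₂ ⇒ c = 0`
by evaluating at the coordinate `1`; same one level up).  Clearing denominators
(`Literature.NumberTheory.Transcendental.exists_nat_mul_eq_intCast`, with the trivial denominator
`1` at the two anchors) gives integer vectors `w_k = d_k b_k`, `d_k ≥ 1`, which lie in `V` and are
linearly independent (`LinearIndependent.units_smul`).

## Contents

* `stub_anchoredBasis` — the registered stub, by name.
-/

noncomputable section

-- `Summit.Schanuel.Schanuel.…` is the mandated summit/sub-problem namespace (single-conjunct summit), hence: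
set_option linter.dupNamespace false

namespace Summit.Schanuel.Schanuel.Cruxes.KhovanskiiApproxTypeEv.AnchoredReduction

open Module Literature.NumberTheory.Transcendental

/-- **An integral basis of `V ∋ e₀, e₁` starting with `e₀, e₁`.** For a `ℚ`-subspace `V` of
`ℚⁿ⁺²` containing the coordinate vectors `e₀ = Pi.single 0 1` and `e₁ = Pi.single 1 1` there are
`m` and integer vectors `w₀, …, w_{m+1} ∈ ℤⁿ⁺²` with `dim_ℚ V = m + 2`, `w₀ = e₀`, `w₁ = e₁`, all
`w_k ∈ V`, and `(w_k)_k` `ℚ`-linearly independent (hence a basis of `V`).  Linear algebra: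
`Module.Basis.mkFinConsOfLE` twice over a basis of `V ⊓ {v | v₀ = v₁ = 0}`, denominators cleared.
[folklore] -/
theorem stub_anchoredBasis : ∀ (n : ℕ) (V : Submodule ℚ (Fin (n + 2) → ℚ)),
    (Pi.single 0 1 : Fin (n + 2) → ℚ) ∈ V → (Pi.single 1 1 : Fin (n + 2) → ℚ) ∈ V →
    ∃ (m : ℕ) (w : Fin (m + 2) → Fin (n + 2) → ℤ), Module.finrank ℚ ↥V = m + 2 ∧
      w 0 = Pi.single 0 1 ∧ w 1 = Pi.single 1 1 ∧ (∀ k, (fun i => (w k i : ℚ)) ∈ V) ∧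
      LinearIndependent ℚ (fun k i => (w k i : ℚ)) := by
  intro n V he0 he1
  classical
  -- `V₁ = {v ∈ V | v 0 = 0}` and `V₂ = {v ∈ V₁ | v 1 = 0}`
  set V₁ : Submodule ℚ (Fin (n + 2) → ℚ) := V ⊓ LinearMap.ker (LinearMap.proj 0) with hV₁
  set V₂ : Submodule ℚ (Fin (n + 2) → ℚ) := V₁ ⊓ LinearMap.ker (LinearMap.proj 1) with hV₂
  have hmem1 : ∀ v, v ∈ V₁ ↔ v ∈ V ∧ v 0 = 0 := fun v => by
    simp only [hV₁, Submodule.mem_inf, LinearMap.mem_ker, LinearMap.proj_apply]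
  have hmem2 : ∀ v, v ∈ V₂ ↔ (v ∈ V ∧ v 0 = 0) ∧ v 1 = 0 := fun v => by
    simp only [hV₂, hV₁, Submodule.mem_inf, LinearMap.mem_ker, LinearMap.proj_apply]
  have h21 : V₂ ≤ V₁ := inf_le_left
  have h1V : V₁ ≤ V := inf_le_left
  haveI : FiniteDimensional ℚ V₂ := FiniteDimensional.finiteDimensional_submodule V₂
  let b₂ := Module.finBasis ℚ V₂
  set m := Module.finrank ℚ V₂ with hm
  have he1' : (Pi.single 1 1 : Fin (n + 2) → ℚ) ∈ V₁ := (hmem1 _).mpr ⟨he1, by simp⟩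
  -- extend by `e₁` to a basis of `V₁`, then by `e₀` to a basis of `V`
  let b₁ : Basis (Fin (m + 1)) ℚ V₁ := Basis.mkFinConsOfLE (Pi.single 1 1) he1' b₂ h21
    (fun c x hx hc => by
      have h := congr_fun hc 1
      have hx1 : x 1 = 0 := ((hmem2 x).mp hx).2
      simpa [hx1] using h)
    (fun z hz => ⟨-(z 1), (hmem2 _).mpr ⟨⟨V.add_mem (h1V hz) (V.smul_mem _ he1), by
        simp [((hmem1 z).mp hz).2]⟩, by simp⟩⟩)
  let b : Basis (Fin (m + 2)) ℚ V := Basis.mkFinConsOfLE (Pi.single 0 1) he0 b₁ h1V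
    (fun c x hx hc => by
      have h := congr_fun hc 0
      have hx0 : x 0 = 0 := ((hmem1 x).mp hx).2
      simpa [hx0] using h)
    (fun z hz => ⟨-(z 0), (hmem1 _).mpr ⟨V.add_mem hz (V.smul_mem _ he0), by simp⟩⟩)
  have hVm : Module.finrank ℚ V = m + 2 := by
    rw [Module.finrank_eq_card_basis b, Fintype.card_fin]
  -- the basis vectors as rational vectors `u k`, with `u 0 = e₀`, `u 1 = e₁`
  set u : Fin (m + 2) → Fin (n + 2) → ℚ := fun k => ((b k : V) : Fin (n + 2) → ℚ) with hu
  have hu0 : u 0 = Pi.single 0 1 := by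
    simp [hu, b, Basis.coe_mkFinConsOfLE]
  have hu1 : u 1 = Pi.single 1 1 := by
    simp [hu, b, b₁, Basis.coe_mkFinConsOfLE]
  have hli_b : LinearIndependent ℚ u := b.linearIndependent.map' V.subtype (Submodule.ker_subtype V)
  -- clearing denominators (denominator `1` at the anchors)
  have hint : ∀ k : Fin (m + 2), ∃ d : ℕ, d ≠ 0 ∧ ∃ w : Fin (n + 2) → ℤ,
      (∀ i, (d : ℚ) * u k i = w i) ∧ (k = 0 → w = Pi.single 0 1) ∧ (k = 1 → w = Pi.single 1 1) := by
    intro k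
    by_cases hk0 : k = 0
    · subst hk0
      refine ⟨1, one_ne_zero, Pi.single 0 1, fun i => ?_, fun _ => rfl, fun h => absurd h (by simp)⟩
      rw [hu0]
      simp [Pi.single_apply]
    by_cases hk1 : k = 1
    · subst hk1
      refine ⟨1, one_ne_zero, Pi.single 1 1, fun i => ?_, fun h => absurd h hk0, fun _ => rfl⟩
      rw [hu1]
      simp [Pi.single_apply]
    obtain ⟨d, hd, w, hw⟩ := exists_nat_mul_eq_intCast (u k)
    exact ⟨d, hd, w, hw, fun h => absurd h hk0, fun h => absurd h hk1⟩
  choose d hd w hw hw0 hw1 using hint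
  refine ⟨m, w, hVm, hw0 0 rfl, hw1 1 rfl, fun k => ?_, ?_⟩
  · have : (fun i => (w k i : ℚ)) = (d k : ℚ) • u k := by
      funext i; rw [Pi.smul_apply, smul_eq_mul, hw]
    rw [this]
    exact V.smul_mem _ (b k).2
  · have hb2 := hli_b.units_smul fun k => Units.mk0 (d k : ℚ) (Nat.cast_ne_zero.mpr (hd k))
    convert hb2 using 1
    funext k i
    change (w k i : ℚ) = ((Units.mk0 (d k : ℚ) (Nat.cast_ne_zero.mpr (hd k))) • u k) i
    rw [Units.smul_def, Units.val_mk0, Pi.smul_apply, smul_eq_mul, hw]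

end Summit.Schanuel.Schanuel.Cruxes.KhovanskiiApproxTypeEv.AnchoredReduction

end
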